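import Summits.KontsevichZagierPeriods.KontsevichZagierPeriods.Theorems.HurwitzMicroSectorsHurwitzSectorComplementStubLadderEngineAux2

/-!
# `HurwitzSectorComplement` (stmt-KontsevichZagierPeriods-14341, route HurwitzMicroSectors),
# line `chebyshev-level-deformation`: stub `stub_ladderEngine` (S1) — the two Newton–Leibniz moves

The two moves of one ladder step, for an abstract kernel pair: **Move A** = rule (3) of the
Kontsevich–Zagier calculus in a new last coordinate `v' ∈ [0, κ]` over the stage domain
`S (m+2) j V` with primitive `Ω · K(v'; P)`, and **Move B** = rule (3) in the last box coordinate
`x ∈ [0, 1]` over `S (m+1) (j+1) V` with primitive `ε Ω' · x · K̃(κ'; P' x)`; plus the two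
integrability inputs: the band of Move A converges absolutely (Tonelli, fibre bound
`∫ |∂_v K| ≤ 2π/(1−P)`), and the boundary term of a Newton–Leibniz band is integrable as soon as
the band integrand is (Fubini + FTC). Reference: M. Kontsevich, D. Zagier, *Periods* (2001), §1.2.
-/

noncomputable section

open Set MeasureTheory
open scoped BigOperators ENNReal
open Literature.NumberTheory.Transcendental

namespace Summit.KontsevichZagierPeriods.Theorems.HurwitzMicroSectorsHurwitzSectorComplement

namespace LadderEngine

open Literature.ModelTheory.ExponentialFields (IsSemialgebraic)

/-! ### Integrability of the boundary term of a band -/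

/-- **The boundary term of a Newton–Leibniz band is integrable when the band integrand is**:
`∫_B |F(x,b x) − F(x,a x)| dx ≤ ∫_band |f|` (Fubini along the last coordinate, then the
fundamental theorem of calculus on a.e. fibre). [cite: KontsevichZagier2001, §1.2 rule (3)] -/
theorem integrableOn_boundary_of_band {N : ℕ} {B : Set (Fin N → ℝ)} (hB : MeasurableSet B)
    {a b : (Fin N → ℝ) → ℝ} (hab : ∀ x ∈ B, a x ≤ b x) (hband : MeasurableSet (KZlog.band B a b))
    {F f : (Fin (N + 1) → ℝ) → ℝ} (hint : IntegrableOn f (KZlog.band B a b))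
    (hcont : ∀ x ∈ B, ContinuousOn (fun t : ℝ => F (Fin.snoc x t)) (Icc (a x) (b x)))
    (hder : ∀ x ∈ B, ∀ t ∈ Ioo (a x) (b x),
      HasDerivAt (fun t : ℝ => F (Fin.snoc x t)) (f (Fin.snoc x t)) t) :
    IntegrableOn (fun x => F (Fin.snoc x (b x)) - F (Fin.snoc x (a x))) B := by
  set G : (Fin (N + 1) → ℝ) → ℝ := (KZlog.band B a b).indicator f with hG_def
  have hG : Integrable G := (integrable_indicator_iff hband).mpr hint
  obtain ⟨-, hae⟩ := KZexp.integral_eq_integral_integral_snoc hG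
  set e : (Fin (N + 1) → ℝ) ≃ᵐ ℝ × (Fin N → ℝ) :=
    MeasurableEquiv.piFinSuccAbove (fun _ => ℝ) (Fin.last N) with he_def
  have he : MeasurePreserving e volume volume :=
    volume_preserving_piFinSuccAbove (fun _ => ℝ) (Fin.last N)
  have he_symm : ∀ p : ℝ × (Fin N → ℝ), e.symm p = Fin.snoc p.2 p.1 := fun p => by
    simp [he_def, MeasurableEquiv.piFinSuccAbove, Fin.snocEquiv]
  have hG2 : Integrable (fun p : ℝ × (Fin N → ℝ) => G (Fin.snoc p.2 p.1))
      ((volume : Measure ℝ).prod (volume : Measure (Fin N → ℝ))) := by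
    have h := ((he.symm e).integrable_comp_emb e.symm.measurableEmbedding (g := G)).mpr hG
    rw [← Measure.volume_eq_prod]
    convert h using 1
    ext p
    simp [he_symm]
  have hI : Integrable (fun x : Fin N → ℝ => ∫ t : ℝ, G (Fin.snoc x t)) := hG2.integral_prod_right
  refine (hI.integrableOn (s := B)).congr_fun_ae ?_
  filter_upwards [ae_restrict_mem hB, ae_restrict_of_ae hae] with x hx hxint
  have hfib : (fun t => G (Fin.snoc x t)) =
      (Icc (a x) (b x)).indicator (fun t => f (Fin.snoc x t)) := by
    ext t
    by_cases ht : t ∈ Icc (a x) (b x)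
    · rw [indicator_of_mem ht, hG_def, indicator_of_mem (KZlog.snoc_mem_band.2 ⟨hx, ht⟩)]
    · rw [indicator_of_notMem ht, hG_def,
        indicator_of_notMem (fun h => ht (KZlog.snoc_mem_band.1 h).2)]
  rw [hfib, integral_indicator measurableSet_Icc, integral_Icc_eq_integral_Ioc,
    ← intervalIntegral.integral_of_le (hab x hx)]
  apply intervalIntegral.integral_eq_sub_of_hasDerivAt_of_le (hab x hx) (hcont x hx) (hder x hx)
  rw [intervalIntegrable_iff_integrableOn_Icc_of_le (hab x hx)]
  have hx' : Integrable (fun t => G (Fin.snoc x t)) := hxint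
  rw [hfib] at hx'
  exact (integrable_indicator_iff measurableSet_Icc).mp hx'

section Moves

variable {g : ℝ → ℝ} {S : (n j : ℕ) → ℝ → Set (Fin (n + j) → ℝ)}
  {Ω P : (n j : ℕ) → (Fin (n + j) → ℝ) → ℝ} {κ : (n j : ℕ) → ℝ → (Fin (n + j) → ℝ) → ℝ}

/-! ### Move A: the band `{(z, v') | z ∈ S (m+2) j V, 0 ≤ v' ≤ κ z}` -/

/-- **Absolute convergence of the band of Move A**: for a kernel derivative with
`|K_v(v;s)| ≤ 2/((1−s)² + v²)` the band integrand `Ω(z) K_v(v'; P z)` is integrable on the band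
(Tonelli: `∫₀^κ |K_v| dv' ≤ 2π/(1 − P)`, and `Ω/(1 − P)` is integrable on the base).
[cite: KontsevichZagier2001, §1.2 rule (3)] -/
theorem integrableOn_bandA
    (hg : ∀ v, g v = 2 / (1 + v ^ 2))
    (hS : ∀ n j V z, z ∈ S n j V ↔ (∀ i : Fin n, z (Fin.castAdd j i) ∈ Set.Ioo (0:ℝ) 1) ∧
      StrictAnti (Fin.cons V (fun i : Fin j => z (Fin.natAdd n i)) : Fin (j + 1) → ℝ) ∧
      0 < (Fin.cons V (fun i : Fin j => z (Fin.natAdd n i)) : Fin (j + 1) → ℝ) (Fin.last j))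
    (hΩ : ∀ n j z, Ω n j z = ∏ i : Fin j, g (z (Fin.natAdd n i)))
    (hP : ∀ n j z, P n j z = ∏ i : Fin n, z (Fin.castAdd j i))
    (hκ : ∀ n j V z, κ n j V z = (Fin.cons V (fun i : Fin j => z (Fin.natAdd n i)) :
      Fin (j + 1) → ℝ) (Fin.last j))
    {V : ℝ} (hV : IsAlgebraic ℚ V)
    (m j : ℕ) (Kv : ℝ → ℝ → ℝ)
    (hbound : ∀ v s, 0 ≤ v → 0 ≤ s → s < 1 → |Kv v s| ≤ 2 / ((1 - s) ^ 2 + v ^ 2))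
    (hsa : IsSemialgebraicFunOn ℚ (KZlog.band (S (m + 2) j V) (fun _ => 0) (κ (m + 2) j V))
      (fun w => Ω (m + 2) j (Fin.init w) * Kv (w (Fin.last _)) (P (m + 2) j (Fin.init w)))) :
    IntegrableOn (fun w => Ω (m + 2) j (Fin.init w) * Kv (w (Fin.last _)) (P (m + 2) j (Fin.init w)))
      (KZlog.band (S (m + 2) j V) (fun _ => 0) (κ (m + 2) j V)) := by
  have hB := isSemialgebraic_S hS hV (m + 2) j
  have hBm := measurableSet_S hS hV (m + 2) j
  have hband : IsSemialgebraic ℚ (KZlog.band (S (m + 2) j V) (fun _ => (0 : ℝ)) (κ (m + 2) j V)) :=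
    KZlog.isSemialgebraic_band (by simpa using isSemialgebraicFunOn_ratCast hB 0)
      (sa_κ hκ hV (m + 2) j hB)
  have hbandm := IsSemialgebraic.measurableSet_holds hband
  refine KZlog.integrableOn_band_of_lintegral_fibre_le hBm hbandm (fun x t => KZlog.snoc_mem_band)
    (KZ.aestronglyMeasurable_of_isSemialgebraicFunOn hsa hbandm)
    (K := fun x => 2 * Real.pi * Ω (m + 2) j x / (1 - P (m + 2) j x)) (fun x hx => ?_) ?_
  · have hP01 := P_mem_Ioo hS hP (by omega) hx
    have hΩ0 := (Ω_nonneg_le hg hΩ (m + 2) j x).1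
    simp only [Fin.init_snoc, Fin.snoc_last]
    exact lintegral_Icc_enorm_le hΩ0 (sub_pos.2 hP01.2) fun t ht => by
      rw [abs_mul, abs_of_nonneg hΩ0]
      exact mul_le_mul_of_nonneg_left (hbound t _ ht.1 hP01.1.le hP01.2) hΩ0
  · have h : IntegrableOn (fun x => 2 * Real.pi * (Ω (m + 2) j x / (1 - P (m + 2) j x)))
        (S (m + 2) j V) :=
      (integrableOn_Ω_div hg hS hΩ hP hV m j).const_mul (2 * Real.pi)
    exact h.congr_fun (fun x _ => by ring) hBm

/-- **Move A** (rule (3) in the new last coordinate `v'`, primitive `F(z,v') = Ω(z) K(v'; P z)`):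
the band representation `[{z ∈ S (m+2) j V, 0 ≤ v' ≤ κ z}, Ω ∂_vK(v'; P)]` and the boundary
representation `[S (m+2) j V, Ω K(κ; P) − Ω K(0; P)]` exist and differ by a relation.
[cite: KontsevichZagier2001, §1.2 rule (3)] -/
theorem moveA
    (hg : ∀ v, g v = 2 / (1 + v ^ 2))
    (hS : ∀ n j V z, z ∈ S n j V ↔ (∀ i : Fin n, z (Fin.castAdd j i) ∈ Set.Ioo (0:ℝ) 1) ∧
      StrictAnti (Fin.cons V (fun i : Fin j => z (Fin.natAdd n i)) : Fin (j + 1) → ℝ) ∧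
      0 < (Fin.cons V (fun i : Fin j => z (Fin.natAdd n i)) : Fin (j + 1) → ℝ) (Fin.last j))
    (hΩ : ∀ n j z, Ω n j z = ∏ i : Fin j, g (z (Fin.natAdd n i)))
    (hP : ∀ n j z, P n j z = ∏ i : Fin n, z (Fin.castAdd j i))
    (hκ : ∀ n j V z, κ n j V z = (Fin.cons V (fun i : Fin j => z (Fin.natAdd n i)) :
      Fin (j + 1) → ℝ) (Fin.last j))
    {V : ℝ} (hV : IsAlgebraic ℚ V)
    (m j : ℕ) (K Kv : ℝ → ℝ → ℝ)
    (hder : ∀ s v, (1 - s) ^ 2 + v ^ 2 * (1 + s) ^ 2 ≠ 0 → HasDerivAt (fun v => K v s) (Kv v s) v)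
    (hcontK : ∀ s : ℝ, s < 1 → ∀ c : ℝ, Continuous (fun v => c * K v s))
    (hbound : ∀ v s, 0 ≤ v → 0 ≤ s → s < 1 → |Kv v s| ≤ 2 / ((1 - s) ^ 2 + v ^ 2))
    (hsaK : ∀ {N : ℕ} {σ : Set (Fin N → ℝ)} {a b : (Fin N → ℝ) → ℝ}, IsSemialgebraic ℚ σ →
      IsSemialgebraicFunOn ℚ σ a → IsSemialgebraicFunOn ℚ σ b →
      (∀ x ∈ σ, (1 - b x) ^ 2 + (a x) ^ 2 * (1 + b x) ^ 2 ≠ 0) →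
      IsSemialgebraicFunOn ℚ σ (fun x => K (a x) (b x)))
    (hsaKv : ∀ {N : ℕ} {σ : Set (Fin N → ℝ)} {a b : (Fin N → ℝ) → ℝ}, IsSemialgebraic ℚ σ →
      IsSemialgebraicFunOn ℚ σ a → IsSemialgebraicFunOn ℚ σ b →
      (∀ x ∈ σ, (1 - b x) ^ 2 + (a x) ^ 2 * (1 + b x) ^ 2 ≠ 0) →
      IsSemialgebraicFunOn ℚ σ (fun x => Kv (a x) (b x))) :
    ∃ (rb : KZ.IntegralRep (m + 2 + j + 1)) (rd : KZ.IntegralRep (m + 2 + j)),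
      rb.domain = KZlog.band (S (m + 2) j V) (fun _ => 0) (κ (m + 2) j V) ∧
      (rb.integrand = fun w => Ω (m + 2) j (Fin.init w) * Kv (w (Fin.last _)) (P (m + 2) j (Fin.init w))) ∧
      rd.domain = S (m + 2) j V ∧
      (rd.integrand = fun x => Ω (m + 2) j x * K (κ (m + 2) j V x) (P (m + 2) j x) -
        Ω (m + 2) j x * K 0 (P (m + 2) j x)) ∧
      KZ.of rb - KZ.of rd ∈ KZ.relations := by
  set F : (Fin (m + 2 + j + 1) → ℝ) → ℝ :=
    fun w => Ω (m + 2) j (Fin.init w) * K (w (Fin.last _)) (P (m + 2) j (Fin.init w)) with hF_def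
  set f : (Fin (m + 2 + j + 1) → ℝ) → ℝ :=
    fun w => Ω (m + 2) j (Fin.init w) * Kv (w (Fin.last _)) (P (m + 2) j (Fin.init w)) with hf_def
  have hB := isSemialgebraic_S hS hV (m + 2) j
  have hBm := measurableSet_S hS hV (m + 2) j
  have ha : IsSemialgebraicFunOn ℚ (S (m + 2) j V) (fun _ => (0 : ℝ)) := by
    simpa using isSemialgebraicFunOn_ratCast hB 0
  have hb : IsSemialgebraicFunOn ℚ (S (m + 2) j V) (κ (m + 2) j V) := sa_κ hκ hV (m + 2) j hB
  have hab : ∀ x ∈ S (m + 2) j V, (fun _ => (0 : ℝ)) x ≤ κ (m + 2) j V x :=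
    fun x hx => (κ_pos hS hκ hx).le
  have hband : IsSemialgebraic ℚ (KZlog.band (S (m + 2) j V) (fun _ => (0 : ℝ)) (κ (m + 2) j V)) :=
    KZlog.isSemialgebraic_band ha hb
  have hbandm := IsSemialgebraic.measurableSet_holds hband
  -- semialgebraic building blocks on the band
  have hΩi : IsSemialgebraicFunOn ℚ (KZlog.band (S (m + 2) j V) (fun _ => (0 : ℝ)) (κ (m + 2) j V))
      (fun w => Ω (m + 2) j (Fin.init w)) :=
    (sa_Ω hg hΩ (m + 2) j Literature.ModelTheory.ExponentialFields.isSemialgebraic_univ).comp_init_mono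
      hband fun _ _ => mem_univ _
  have hPi : IsSemialgebraicFunOn ℚ (KZlog.band (S (m + 2) j V) (fun _ => (0 : ℝ)) (κ (m + 2) j V))
      (fun w => P (m + 2) j (Fin.init w)) :=
    (sa_P hP (m + 2) j Literature.ModelTheory.ExponentialFields.isSemialgebraic_univ).comp_init_mono
      hband fun _ _ => mem_univ _
  have hlast := isSemialgebraicFunOn_apply hband (Fin.last (m + 2 + j))
  have hDband : ∀ w ∈ KZlog.band (S (m + 2) j V) (fun _ => (0 : ℝ)) (κ (m + 2) j V),
      (1 - P (m + 2) j (Fin.init w)) ^ 2 + (w (Fin.last _)) ^ 2 * (1 + P (m + 2) j (Fin.init w)) ^ 2 ≠ 0 :=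
    fun w hw => (D_pos_of_lt _ (P_mem_Ioo hS hP (by omega) hw.1).2).ne'
  have hF : IsSemialgebraicFunOn ℚ (KZlog.band (S (m + 2) j V) (fun _ => (0 : ℝ)) (κ (m + 2) j V)) F :=
    sa_mul hΩi (hsaK hband hlast hPi hDband)
  have hf : IsSemialgebraicFunOn ℚ (KZlog.band (S (m + 2) j V) (fun _ => (0 : ℝ)) (κ (m + 2) j V)) f :=
    sa_mul hΩi (hsaKv hband hlast hPi hDband)
  -- fibrewise regularity
  have hcont : ∀ x ∈ S (m + 2) j V, ContinuousOn (fun t : ℝ => F (Fin.snoc x t))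
      (Icc ((fun _ => (0 : ℝ)) x) (κ (m + 2) j V x)) := by
    intro x hx
    simp only [hF_def, Fin.init_snoc, Fin.snoc_last]
    exact (hcontK _ (P_mem_Ioo hS hP (by omega) hx).2 _).continuousOn
  have hder' : ∀ x ∈ S (m + 2) j V, ∀ t ∈ Ioo ((fun _ => (0 : ℝ)) x) (κ (m + 2) j V x),
      HasDerivAt (fun t : ℝ => F (Fin.snoc x t)) (f (Fin.snoc x t)) t := by
    intro x hx t _
    simp only [hF_def, hf_def, Fin.init_snoc, Fin.snoc_last]
    exact (hder _ t (D_pos_of_lt t (P_mem_Ioo hS hP (by omega) hx).2).ne').const_mul _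
  have hint : IntegrableOn f (KZlog.band (S (m + 2) j V) (fun _ => 0) (κ (m + 2) j V)) :=
    integrableOn_bandA hg hS hΩ hP hκ hV m j Kv hbound hf
  have hdi := integrableOn_boundary_of_band hBm hab hbandm hint hcont hder'
  have hds : IsSemialgebraicFunOn ℚ (S (m + 2) j V)
      (fun x => F (Fin.snoc x (κ (m + 2) j V x)) - F (Fin.snoc x ((fun _ => (0 : ℝ)) x))) := by
    have hΩs := sa_Ω hg hΩ (m + 2) j hB
    have hPs := sa_P hP (m + 2) j hB
    have hD1 : ∀ x ∈ S (m + 2) j V,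
        (1 - P (m + 2) j x) ^ 2 + (κ (m + 2) j V x) ^ 2 * (1 + P (m + 2) j x) ^ 2 ≠ 0 :=
      fun x hx => (D_pos_of_lt _ (P_mem_Ioo hS hP (by omega) hx).2).ne'
    have hD0 : ∀ x ∈ S (m + 2) j V,
        (1 - P (m + 2) j x) ^ 2 + ((fun _ => (0 : ℝ)) x) ^ 2 * (1 + P (m + 2) j x) ^ 2 ≠ 0 :=
      fun x hx => (D_pos_of_lt _ (P_mem_Ioo hS hP (by omega) hx).2).ne'
    exact (sa_sub (sa_mul hΩs (hsaK hB hb hPs hD1)) (sa_mul hΩs (hsaK hB ha hPs hD0))).congr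
      fun x _ => by simp only [hF_def, Fin.init_snoc, Fin.snoc_last]
  obtain ⟨rb, rd, h1, h2, h3, h4, h5⟩ := KZ.exists_band_newtonLeibniz hB _ _ ha hb hab F f hF hf
    hcont hder' hint hds hdi
  refine ⟨rb, rd, h1, h2, h3, ?_, h5⟩
  rw [h4]
  funext x
  simp only [hF_def, Fin.init_snoc, Fin.snoc_last]

/-! ### Move B: the band `{(y, x) | y ∈ S (m+1) (j+1) V, 0 ≤ x ≤ 1}` -/

/-- The weight of the first `j` parameters of `y ∈ ℝ^{(m+1)+(j+1)}` is semialgebraic.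
[cite: BochnakCosteRoy1998, Prop. 2.2.6] -/
theorem sa_Ωinit (hg : ∀ v, g v = 2 / (1 + v ^ 2)) (m j : ℕ)
    {σ : Set (Fin (m + 1 + (j + 1)) → ℝ)} (hσ : IsSemialgebraic ℚ σ) :
    IsSemialgebraicFunOn ℚ σ
      (fun y => ∏ i : Fin j, g (y (Fin.natAdd (m + 1) (Fin.castSucc i)))) :=
  Summit.KontsevichZagierPeriods.ArrangementNormalForm.JanusBands.IntegrateOut.isSemialgebraicFunOn_finset_prod Finset.univ hσ fun i _ =>
    sa_g hg hσ (isSemialgebraicFunOn_apply hσ (Fin.natAdd (m + 1) (Fin.castSucc i)))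

/-- `Ω' = Ω⁻ · g(κ')`: the weight of all `j + 1` parameters is the weight of the first `j` ones
times `g` of the last one (the kernel parameter). [folklore] -/
theorem Ω_succ_eq (hΩ : ∀ n j z, Ω n j z = ∏ i : Fin j, g (z (Fin.natAdd n i)))
    (hκ : ∀ n j V z, κ n j V z = (Fin.cons V (fun i : Fin j => z (Fin.natAdd n i)) :
      Fin (j + 1) → ℝ) (Fin.last j)) (m j : ℕ) (V : ℝ)
    (y : Fin (m + 1 + (j + 1)) → ℝ) :
    Ω (m + 1) (j + 1) y =
      (∏ i : Fin j, g (y (Fin.natAdd (m + 1) (Fin.castSucc i)))) * g (κ (m + 1) (j + 1) V y) := by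
  rw [hΩ, hκ, Fin.prod_univ_castSucc, ← Fin.succ_last, Fin.cons_succ]

/-- **Move B** (rule (3) in the last box coordinate `x ∈ [0,1]` over `S (m+1) (j+1) V`,
primitive `H(y,x) = ε Ω'(y) · x · K̃(κ' y; P' y · x)` with `∂ₓH = Ω⁻(y) K_v(κ' y; P' y · x)`):
given absolute convergence of the band, the band representation and the boundary representation
`[S (m+1) (j+1) V, ε Ω' K̃(κ'; P')]` exist and differ by a relation.
[cite: KontsevichZagier2001, §1.2 rule (3)] -/
theorem moveB
    (hg : ∀ v, g v = 2 / (1 + v ^ 2))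
    (hS : ∀ n j V z, z ∈ S n j V ↔ (∀ i : Fin n, z (Fin.castAdd j i) ∈ Set.Ioo (0:ℝ) 1) ∧
      StrictAnti (Fin.cons V (fun i : Fin j => z (Fin.natAdd n i)) : Fin (j + 1) → ℝ) ∧
      0 < (Fin.cons V (fun i : Fin j => z (Fin.natAdd n i)) : Fin (j + 1) → ℝ) (Fin.last j))
    (hΩ : ∀ n j z, Ω n j z = ∏ i : Fin j, g (z (Fin.natAdd n i)))
    (hP : ∀ n j z, P n j z = ∏ i : Fin n, z (Fin.castAdd j i))
    (hκ : ∀ n j V z, κ n j V z = (Fin.cons V (fun i : Fin j => z (Fin.natAdd n i)) :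
      Fin (j + 1) → ℝ) (Fin.last j))
    {V : ℝ} (hV : IsAlgebraic ℚ V)
    (m j : ℕ) (ε : ℚ) (Kp Kv : ℝ → ℝ → ℝ)
    (hderB : ∀ v p x, (1 - p * x) ^ 2 + v ^ 2 * (1 + p * x) ^ 2 ≠ 0 →
      HasDerivAt (fun x => (ε : ℝ) * g v * (x * Kp v (p * x))) (Kv v (p * x)) x)
    (hcontB : ∀ v : ℝ, v ≠ 0 → ∀ c p : ℝ, Continuous (fun x : ℝ => c * (x * Kp v (p * x))))
    (hsaKp : ∀ {N : ℕ} {σ : Set (Fin N → ℝ)} {a b : (Fin N → ℝ) → ℝ}, IsSemialgebraic ℚ σ →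
      IsSemialgebraicFunOn ℚ σ a → IsSemialgebraicFunOn ℚ σ b →
      (∀ x ∈ σ, (1 - b x) ^ 2 + (a x) ^ 2 * (1 + b x) ^ 2 ≠ 0) →
      IsSemialgebraicFunOn ℚ σ (fun x => Kp (a x) (b x)))
    (hsaKv : ∀ {N : ℕ} {σ : Set (Fin N → ℝ)} {a b : (Fin N → ℝ) → ℝ}, IsSemialgebraic ℚ σ →
      IsSemialgebraicFunOn ℚ σ a → IsSemialgebraicFunOn ℚ σ b →
      (∀ x ∈ σ, (1 - b x) ^ 2 + (a x) ^ 2 * (1 + b x) ^ 2 ≠ 0) →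
      IsSemialgebraicFunOn ℚ σ (fun x => Kv (a x) (b x)))
    (hint : IntegrableOn
      (fun w : Fin (m + 1 + (j + 1) + 1) → ℝ =>
        (∏ i : Fin j, g ((Fin.init w) (Fin.natAdd (m + 1) (Fin.castSucc i)))) *
        Kv (κ (m + 1) (j + 1) V (Fin.init w)) (P (m + 1) (j + 1) (Fin.init w) * w (Fin.last _)))
      (KZlog.band (S (m + 1) (j + 1) V) (fun _ => 0) (fun _ => 1))) :
    ∃ (rb : KZ.IntegralRep (m + 1 + (j + 1) + 1)) (rd : KZ.IntegralRep (m + 1 + (j + 1))),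
      rb.domain = KZlog.band (S (m + 1) (j + 1) V) (fun _ => 0) (fun _ => 1) ∧
      (rb.integrand = fun w =>
        (∏ i : Fin j, g ((Fin.init w) (Fin.natAdd (m + 1) (Fin.castSucc i)))) *
          Kv (κ (m + 1) (j + 1) V (Fin.init w)) (P (m + 1) (j + 1) (Fin.init w) * w (Fin.last _))) ∧
      rd.domain = S (m + 1) (j + 1) V ∧
      (rd.integrand = fun y => (ε : ℝ) * Ω (m + 1) (j + 1) y *
        Kp (κ (m + 1) (j + 1) V y) (P (m + 1) (j + 1) y)) ∧
      KZ.of rb - KZ.of rd ∈ KZ.relations := by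
  set H : (Fin (m + 1 + (j + 1) + 1) → ℝ) → ℝ :=
    fun w => (ε : ℝ) * Ω (m + 1) (j + 1) (Fin.init w) *
      (w (Fin.last _) * Kp (κ (m + 1) (j + 1) V (Fin.init w))
        (P (m + 1) (j + 1) (Fin.init w) * w (Fin.last _))) with hH_def
  set f : (Fin (m + 1 + (j + 1) + 1) → ℝ) → ℝ :=
    fun w => (∏ i : Fin j, g ((Fin.init w) (Fin.natAdd (m + 1) (Fin.castSucc i)))) *
      Kv (κ (m + 1) (j + 1) V (Fin.init w)) (P (m + 1) (j + 1) (Fin.init w) * w (Fin.last _))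
    with hf_def
  have hB := isSemialgebraic_S hS hV (m + 1) (j + 1)
  have hBm := measurableSet_S hS hV (m + 1) (j + 1)
  have ha : IsSemialgebraicFunOn ℚ (S (m + 1) (j + 1) V) (fun _ => (0 : ℝ)) := by
    simpa using isSemialgebraicFunOn_ratCast hB 0
  have hb : IsSemialgebraicFunOn ℚ (S (m + 1) (j + 1) V) (fun _ => (1 : ℝ)) := by
    simpa using isSemialgebraicFunOn_ratCast hB 1
  have hab : ∀ x ∈ S (m + 1) (j + 1) V, (fun _ => (0 : ℝ)) x ≤ (fun _ => (1 : ℝ)) x :=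
    fun _ _ => zero_le_one
  have hband : IsSemialgebraic ℚ (KZlog.band (S (m + 1) (j + 1) V) (fun _ => (0 : ℝ)) (fun _ => 1)) :=
    KZlog.isSemialgebraic_band ha hb
  have hbandm := IsSemialgebraic.measurableSet_holds hband
  have hκ0 : ∀ y ∈ S (m + 1) (j + 1) V, κ (m + 1) (j + 1) V y ≠ 0 := fun y hy => (κ_pos hS hκ hy).ne'
  -- semialgebraic building blocks on the band
  have hΩi : IsSemialgebraicFunOn ℚ (KZlog.band (S (m + 1) (j + 1) V) (fun _ => (0 : ℝ)) (fun _ => 1))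
      (fun w => Ω (m + 1) (j + 1) (Fin.init w)) :=
    (sa_Ω hg hΩ (m + 1) (j + 1) Literature.ModelTheory.ExponentialFields.isSemialgebraic_univ).comp_init_mono
      hband fun _ _ => mem_univ _
  have hΩmi : IsSemialgebraicFunOn ℚ (KZlog.band (S (m + 1) (j + 1) V) (fun _ => (0 : ℝ)) (fun _ => 1))
      (fun w => ∏ i : Fin j, g ((Fin.init w) (Fin.natAdd (m + 1) (Fin.castSucc i)))) :=
    (sa_Ωinit hg m j Literature.ModelTheory.ExponentialFields.isSemialgebraic_univ).comp_init_mono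
      hband fun _ _ => mem_univ _
  have hPi : IsSemialgebraicFunOn ℚ (KZlog.band (S (m + 1) (j + 1) V) (fun _ => (0 : ℝ)) (fun _ => 1))
      (fun w => P (m + 1) (j + 1) (Fin.init w)) :=
    (sa_P hP (m + 1) (j + 1) Literature.ModelTheory.ExponentialFields.isSemialgebraic_univ).comp_init_mono
      hband fun _ _ => mem_univ _
  have hκi : IsSemialgebraicFunOn ℚ (KZlog.band (S (m + 1) (j + 1) V) (fun _ => (0 : ℝ)) (fun _ => 1))
      (fun w => κ (m + 1) (j + 1) V (Fin.init w)) :=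
    (sa_κ hκ hV (m + 1) (j + 1) Literature.ModelTheory.ExponentialFields.isSemialgebraic_univ).comp_init_mono
      hband fun _ _ => mem_univ _
  have hlast := isSemialgebraicFunOn_apply hband (Fin.last (m + 1 + (j + 1)))
  have hPx : IsSemialgebraicFunOn ℚ (KZlog.band (S (m + 1) (j + 1) V) (fun _ => (0 : ℝ)) (fun _ => 1))
      (fun w => P (m + 1) (j + 1) (Fin.init w) * w (Fin.last _)) := sa_mul hPi hlast
  have hDband : ∀ w ∈ KZlog.band (S (m + 1) (j + 1) V) (fun _ => (0 : ℝ)) (fun _ => 1),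
      (1 - P (m + 1) (j + 1) (Fin.init w) * w (Fin.last _)) ^ 2 +
        (κ (m + 1) (j + 1) V (Fin.init w)) ^ 2 *
          (1 + P (m + 1) (j + 1) (Fin.init w) * w (Fin.last _)) ^ 2 ≠ 0 :=
    fun w hw => (D_pos_of_ne _ (hκ0 _ hw.1)).ne'
  have hε : IsSemialgebraicFunOn ℚ (KZlog.band (S (m + 1) (j + 1) V) (fun _ => (0 : ℝ)) (fun _ => 1))
      (fun _ => (ε : ℝ)) := isSemialgebraicFunOn_ratCast hband ε
  have hF : IsSemialgebraicFunOn ℚ (KZlog.band (S (m + 1) (j + 1) V) (fun _ => (0 : ℝ)) (fun _ => 1)) H :=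
    sa_mul (sa_mul hε hΩi) (sa_mul hlast (hsaKp hband hκi hPx hDband))
  have hf : IsSemialgebraicFunOn ℚ (KZlog.band (S (m + 1) (j + 1) V) (fun _ => (0 : ℝ)) (fun _ => 1)) f :=
    sa_mul hΩmi (hsaKv hband hκi hPx hDband)
  -- fibrewise regularity
  have hcont : ∀ y ∈ S (m + 1) (j + 1) V, ContinuousOn (fun t : ℝ => H (Fin.snoc y t))
      (Icc ((fun _ => (0 : ℝ)) y) ((fun _ => (1 : ℝ)) y)) := by
    intro y hy
    simp only [hH_def, Fin.init_snoc, Fin.snoc_last]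
    exact (hcontB _ (hκ0 y hy) _ _).continuousOn
  have hder' : ∀ y ∈ S (m + 1) (j + 1) V, ∀ t ∈ Ioo ((fun _ => (0 : ℝ)) y) ((fun _ => (1 : ℝ)) y),
      HasDerivAt (fun t : ℝ => H (Fin.snoc y t)) (f (Fin.snoc y t)) t := by
    intro y hy t _
    simp only [hH_def, hf_def, Fin.init_snoc, Fin.snoc_last]
    have h := (hderB (κ (m + 1) (j + 1) V y) (P (m + 1) (j + 1) y) t
      (D_pos_of_ne _ (hκ0 y hy)).ne').const_mul
      (∏ i : Fin j, g (y (Fin.natAdd (m + 1) (Fin.castSucc i))))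
    have hfun : (fun t : ℝ => (ε : ℝ) * Ω (m + 1) (j + 1) y *
        (t * Kp (κ (m + 1) (j + 1) V y) (P (m + 1) (j + 1) y * t))) =
        fun t => (∏ i : Fin j, g (y (Fin.natAdd (m + 1) (Fin.castSucc i)))) *
          ((ε : ℝ) * g (κ (m + 1) (j + 1) V y) *
            (t * Kp (κ (m + 1) (j + 1) V y) (P (m + 1) (j + 1) y * t))) := by
      funext t
      rw [Ω_succ_eq hΩ hκ m j V y]
      ring
    rw [hfun]
    exact h
  have hdi := integrableOn_boundary_of_band hBm hab hbandm hint hcont hder'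
  have hds : IsSemialgebraicFunOn ℚ (S (m + 1) (j + 1) V) (fun y =>
      H (Fin.snoc y ((fun _ => (1 : ℝ)) y)) - H (Fin.snoc y ((fun _ => (0 : ℝ)) y))) := by
    have hD1 : ∀ y ∈ S (m + 1) (j + 1) V,
        (1 - P (m + 1) (j + 1) y) ^ 2 + (κ (m + 1) (j + 1) V y) ^ 2 * (1 + P (m + 1) (j + 1) y) ^ 2 ≠ 0 :=
      fun y hy => (D_pos_of_ne _ (hκ0 y hy)).ne'
    exact (sa_mul (sa_mul (isSemialgebraicFunOn_ratCast hB ε) (sa_Ω hg hΩ (m + 1) (j + 1) hB))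
      (hsaKp hB (sa_κ hκ hV (m + 1) (j + 1) hB) (sa_P hP (m + 1) (j + 1) hB) hD1)).congr
      fun y _ => by simp [hH_def]
  obtain ⟨rb, rd, h1, h2, h3, h4, h5⟩ := KZ.exists_band_newtonLeibniz hB _ _ ha hb hab H f hF hf
    hcont hder' hint hds hdi
  refine ⟨rb, rd, h1, h2, h3, ?_, h5⟩
  rw [h4]
  funext y
  simp [hH_def]

end Moves

end LadderEngine

/-- **Anchor of this helper file (registered sub-goal): the boundary term of a Newton–Leibniz band
is integrable when the band integrand is.** [cite: KontsevichZagier2001, §1.2 rule (3)] -/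
theorem ladderEngine_boundaryIntegrable : ∀ (N : ℕ) (B : Set (Fin N → ℝ)) (a b : (Fin N → ℝ) → ℝ) (F f : (Fin (N + 1) → ℝ) → ℝ), MeasurableSet B → (∀ x ∈ B, a x ≤ b x) → MeasurableSet (Literature.NumberTheory.Transcendental.KZlog.band B a b) → MeasureTheory.IntegrableOn f (Literature.NumberTheory.Transcendental.KZlog.band B a b) → (∀ x ∈ B, ContinuousOn (fun t : ℝ => F (Fin.snoc x t)) (Set.Icc (a x) (b x))) → (∀ x ∈ B, ∀ t ∈ Set.Ioo (a x) (b x), HasDerivAt (fun t : ℝ => F (Fin.snoc x t)) (f (Fin.snoc x t)) t) → MeasureTheory.IntegrableOn (fun x => F (Fin.snoc x (b x)) - F (Fin.snoc x (a x))) B :=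
  fun _ _ _ _ _ _ hB hab hband hint hcont hder =>
    LadderEngine.integrableOn_boundary_of_band hB hab hband hint hcont hder

end Summit.KontsevichZagierPeriods.Theorems.HurwitzMicroSectorsHurwitzSectorComplement

end
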